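import Summits.BirchSwinnertonDyer.Rank1Residual.X10.CasselsTatePairingRecordsMinimality
import HarnessLib

/-!
# CTP-on-Sel³ instrument, THEOREM-backed ZEROS: an alternating pairing on a group of order `p⁴` with `p`-rank `2` kills the `p`-torsion; the `Ш`-level and `BSD(E,p)`-level consumers (cell `b2b-bsdres`, unit `b2b-bsdres-x10`, gen 16)

Companion of the records file `CasselsTatePairingRecordsF` (part F), which instantiates §3 below for the
eight ZERO-type CM twists; the module docstring there explains the controls. This file holds the
KERNEL lemmas only (no arithmetic input, no curve). Context (= the module docstring of part F):

HONEST FRAMING (run/shared/lean/b2b/bsd-rank1-residual/, verbatim in every file): the goal of the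
cell is to DELETE the COMBINATION-SHAPED residual classes of the Birch–Swinnerton-Dyer formula for
ALL analytic-rank `≤ 1` elliptic curves over `ℚ` — "full BSD formula for every rank `≤ 1` curve in
class `C`" assembled STRICTLY from published theorems — so that the rank-`≤ 1` remainder becomes
exactly the CONSTRUCTION-SHAPED classes, which are TYPED (missing-input `Prop`s), NOT attempted.
This is not "finishing BSD". Theorems only (no definition, no named fact); NOTHING IS BOOKED here;
no class label changes. Per pair. The curves of this file are CM curves and lie in NO residual class
of the cell (CM rank `0` is covered in print); they are recorded ONLY as instrument CONTROLS.

**What this file is.** Parts A–E record the CTP-on-Sel³ certificate shape "alternating NON-ZERO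
Gram matrix" (`Ш[3^∞] = Ш[3] ≅ (ℤ/3)²`). Part F is the OTHER truth value. §1–§3 are KERNEL
theorems with no arithmetic input: (§1) an alternating bi-additive pairing with trivial left kernel
on a finite additive group of order `p⁴` whose `p`-torsion has order `p²` VANISHES identically on
`A[p] × A[p]` (elementary: `pA` has order `p²`; if `p²A = 0` then `pA = A[p]` and
`B(px′, y) = B(x′, py) = 0`; otherwise `pA` is cyclic, generated by some `c` with `pc ≠ 0`, and
`pc` lies in the left kernel — no structure theorem is used); (§2) hence, for `E/K` of rank `0` with
`p ∤ #E(K)_tors`, `#Sel^(p)(E/K) = p²` and `#Ш(E/K)[p^∞] = p⁴`, EVERY alternating pairing on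
`Ш(E/K)` whose left kernel consists of divisible elements (the printed properties of the
Cassels–Tate pairing, bsd.S18 = Silverman AEC X.4.14) vanishes on `Ш[p] × Ш[p]`; (§3) over `ℚ`,
`#Ш[p^∞] = p⁴` follows from Miller's `BSD(E,p)` together with the EXACT analytic order
`ord_p #Ш_an = 4`, and the class-free record shape decides `p ∤ #E(ℚ)_tors` (irreducibility of
`E[3]` by a Frobenius witness, Mazur) in the kernel. §4–§5 instantiate this for the EIGHT ZERO-type
CM twists of the gen-15 census (`HOME/b2b-bsdres-x10/g15/ctp-sel3/cm3ns/CM-CONTROLS-3Ns.md` §3):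
quadratic twists of `121b1` (CM by `ℤ[(1+√−11)/2]`) and `256a1` (CM by `ℤ[√−2]`) by fundamental
`D < 0`, `3 ∤ D`, of analytic rank `0` with `dim_𝔽₃ Sel^(3) = 2` (x10b's two descent engines, EXACT,
kit j135665). For these curves `BSD(E,3)` is a THEOREM in print — Rubin, Invent. Math. 103 (1991)
Thm. 12.3 (`3` splits in the CM field, so `3` is good ORDINARY; tree route
`Rubin1991.pPartRankZero_of_cm` ∘ `bsdp_of_pPartRankZero`) — and gen 16 made the analytic order
EXACT: **`#Ш_an = 81` for all eight**, by Birch's twisted modular-symbol formula at the BASE level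
`N₀ ∈ {121, 256}` (Cremona, *Algorithms* 2nd ed. §2.11: `L(f ⊗ χ_D, 1)·√|D| = K₁ · x^−(γ_D)` with
`γ_D = Σ χ_D(a){a/|D|, ∞} ∈ H₁(X₀(N₀), ℤ)`), exact period scaling of the twist's minimal model, and
ONE rational constant per (base, sign) calibrated on a twist inside Cremona's table and re-verified
EXACTLY on 37 further twists in the table (0 failures; kit j142794, 6 839 twists; write-up
`HOME/b2b-bsdres-x10/g16/exact/EXACT-LVALUES.md`). Consequently the THEOREM-side prediction for
the instrument is `G = 0` (the pairing on `Sel^(3) = Ш[3]` is identically zero), and route A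
returned `G = [[0,0],[0,0]]` on the three of them that have a document (c121b1Dm2347, c256a1Dm2479,
c256a1Dm2743; verifier B read all three ACCEPT-TIER1-PF: engines REQUESTS L2163 / L2168 / L2183,
"CM3Ns 4/4 A = B") — the R2-CM controls PASS, now WITHOUT the word "modulo". The record theorems
below take `BSD(E,3)` (`hbsd`), the exact value (`hq`, `hv`), `#Sel^(3) = 9` (`hcard`), `r_an = 0`
(`hr`) and GZK as DISPLAYED binders and conclude the vanishing for ANY pairing with the bsd.S18
properties; nothing of route A's output is an input. These theorems book nothing.

**Status of the displayed binders.** `hGZK` (published); `hr : r_an = 0` (the exact value is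
non-zero); `hcard : #Sel^(3) = 9` (x10b's two engines, exact, j135665); `hbsd : BSD(E,3)` (Rubin
1991 Thm. 12.3 — PUBLISHED; tree route named above, conditional there exactly on the cell's
standing named facts); `hq`/`hv : #Ш_an = 81` (EXACT, gen 16, kit j142794 — Cremona's book §2.11
and Cremona's table values for the calibrating twists 1089e1 / 2304c1); `halt`/`hker` = the printed
properties of the Cassels–Tate pairing (bsd.S18). These theorems book nothing.

References: Cassels 1998 §1 [Cassels1998]; Silverman AEC X.4.14 [SilvermanAEC2009]; Miller 2011
Def. 1.1 [Miller2011LMS]; Mazur 1978 Prop. 6.3 (1) [Mazur1978]; Kraus 1989 [Kraus1989]; K. Rubin,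
Invent. Math. 103 (1991) 25–68, Thm. 12.3 [Rubin1991]; J. E. Cremona, *Algorithms for Modular
Elliptic Curves*, 2nd ed. (1997), §2.8 (2.8.9) and §2.11 Prop. 2.11.2 [Cremona1997]; cell files
X10-AUDIT.md §22, `HOME/b2b-bsdres-x10/g16/exact/`.
-/

set_option autoImplicit false

noncomputable section

open scoped Classical

open WeierstrassCurve Literature.NumberTheory.EllipticCurves
  Literature.NumberTheory.EllipticCurves.Rank1Residual
  Literature.NumberTheory.EllipticCurves.Rank1Residual.Typed
  Literature.NumberTheory.EllipticCurves.Rank1Residual.X11RankOneCertificates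
  Summit.BirchSwinnertonDyer.BirchSwinnertonDyer.Rank1Residual.IntModel
  Summit.BirchSwinnertonDyer.BirchSwinnertonDyer.Rank1Residual.X11RankOne
  Summit.BirchSwinnertonDyer.Rank1Residual.X11b

namespace Summit.BirchSwinnertonDyer.Rank1Residual.X10

section Algebra

variable {A : Type*} [AddCommGroup A] {Q : Type*} [AddCommGroup Q] (B : A →+ A →+ Q)

/-- Moving a scalar across a bi-additive pairing: `B (n • x) y = B x (n • y)`. [folklore] -/
theorem apply_nsmul_comm (n : ℕ) (x y : A) : B (n • x) y = B x (n • y) := by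
  rw [map_nsmul, AddMonoidHom.nsmul_apply, map_nsmul]

/-- Moving an integer scalar across a bi-additive pairing: `B (k • x) y = B x (k • y)`. [folklore] -/
theorem apply_zsmul_comm (k : ℤ) (x y : A) : B (k • x) y = B x (k • y) := by
  rw [map_zsmul, AddMonoidHom.zsmul_apply, map_zsmul]

/-- In an additive commutative group of order `p ^ 4` whose `p`-torsion has order `p ^ 2`, the
multiplication-by-`p` image `pA` has order `p ^ 2` (`#A = #pA · #A[p]`). [folklore] -/
theorem card_range_nsmul_of_card [Finite A] {p : ℕ} [hp : Fact p.Prime]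
    (hA : Nat.card A = p ^ 4) (hAp : Nat.card (AddSubgroup.torsionBy A p) = p ^ 2) :
    Nat.card (nsmulAddMonoidHom (α := A) p).range = p ^ 2 := by
  set f : A →+ A := nsmulAddMonoidHom (α := A) p with hf
  have hker : f.ker = AddSubgroup.torsionBy A p := by
    ext x
    rw [AddMonoidHom.mem_ker, hf, nsmulAddMonoidHom_apply, AddSubgroup.torsionBy.nsmul_iff]
  have h1 : Nat.card A = Nat.card (A ⧸ f.ker) * Nat.card f.ker :=
    AddSubgroup.card_eq_card_quotient_mul_card_addSubgroup f.ker
  have h2 : Nat.card (A ⧸ f.ker) = Nat.card f.range :=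
    Nat.card_congr (QuotientAddGroup.quotientKerEquivRange f).toEquiv
  rw [h2, hker, hA, hAp, show p ^ 4 = p ^ 2 * p ^ 2 by ring] at h1
  exact (mul_right_cancel₀ (pow_ne_zero 2 hp.out.ne_zero) h1).symm

/-- **An alternating pairing with trivial left kernel on a group of order `p⁴` with `#A[p] = p²`
vanishes identically on `A[p] × A[p]`.** Proof: `pA` has order `p²`. If `p² A = 0` then
`pA ⊆ A[p]`, so `pA = A[p]` by counting, whence `B x y = B (p x') y = B x' (p y) = 0` for
`x, y ∈ A[p]`. If `p² A ≠ 0`, some `c = p a₀ ∈ pA` has `p c ≠ 0`, so `c` has order `p²` and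
generates `pA`; then for every `w`, `p w = k c` for some `k ∈ ℤ`, so `p² w = k • (p c)` and
`B (p c) w = B (p² a₀) w = B a₀ (p² w) = k p² B a₀ a₀ = 0`: the non-zero element `p c` lies in the
left kernel — a contradiction. (The group-theoretic content of "`Ш[p^∞] ≅ (ℤ/p²)²` forces the
Cassels–Tate pairing to vanish on `Ш[p]`"; no structure theorem is used.) [folklore] -/
theorem apply_eq_zero_of_alternating_of_card_pow_four [Finite A] {p : ℕ} [hp : Fact p.Prime]
    (halt : ∀ x, B x x = 0) (hnd : ∀ x : A, x ≠ 0 → ∃ y, B x y ≠ 0)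
    (hA : Nat.card A = p ^ 4) (hAp : Nat.card (AddSubgroup.torsionBy A p) = p ^ 2) :
    ∀ x y : A, p • x = 0 → p • y = 0 → B x y = 0 := by
  set f : A →+ A := nsmulAddMonoidHom (α := A) p with hf
  have hC : Nat.card f.range = p ^ 2 := card_range_nsmul_of_card hA hAp
  by_cases hI : ∀ a : A, p ^ 2 • a = 0
  · -- Case I: `pA ⊆ A[p]`, hence `pA = A[p]` by cardinality
    have hle : f.range ≤ AddSubgroup.torsionBy A p := by
      rintro _ ⟨a, rfl⟩
      rw [AddSubgroup.torsionBy.nsmul_iff, hf, nsmulAddMonoidHom_apply, ← mul_smul, ← pow_two]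
      exact hI a
    have heq : f.range = AddSubgroup.torsionBy A p :=
      AddSubgroup.eq_of_le_of_card_ge hle (by rw [hC, hAp])
    intro x y hx hy
    have hxm : x ∈ f.range := by rw [heq]; exact AddSubgroup.torsionBy.nsmul_iff.mpr hx
    obtain ⟨x', rfl⟩ := hxm
    rw [hf, nsmulAddMonoidHom_apply, apply_nsmul_comm, hy, map_zero]
  · -- Case II: some `c = p • a₀ ∈ pA` of order `p²` generates `pA`; `p • c ≠ 0` is in the left kernel
    exfalso
    simp only [not_forall] at hI
    obtain ⟨a₀, ha₀⟩ := hI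
    have hcmem : p • a₀ ∈ f.range := ⟨a₀, by rw [hf, nsmulAddMonoidHom_apply]⟩
    have hpc : p • (p • a₀) ≠ 0 := by rwa [← mul_smul, ← pow_two]
    -- the order of `c` divides `#pA = p²`
    have hdvd : addOrderOf (p • a₀) ∣ p ^ 2 := by
      have h := addOrderOf_dvd_natCard (⟨p • a₀, hcmem⟩ : f.range)
      rw [← AddSubgroup.addOrderOf_coe, hC] at h
      exact h
    obtain ⟨i, hi, hord⟩ := (Nat.dvd_prime_pow hp.out).mp hdvd
    -- and it is not `1` or `p`, since `p • c ≠ 0`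
    have hi2 : i = 2 := by
      by_contra hne
      have hi1 : i ≤ 1 := by omega
      apply hpc
      rw [← addOrderOf_dvd_iff_nsmul_eq_zero, hord]
      exact (pow_dvd_pow p hi1).trans (by rw [pow_one])
    rw [hi2] at hord
    -- so `c` generates `pA`
    have hzle : AddSubgroup.zmultiples (p • a₀) ≤ f.range :=
      AddSubgroup.zmultiples_le_of_mem hcmem
    have hzeq : AddSubgroup.zmultiples (p • a₀) = f.range :=
      AddSubgroup.eq_of_le_of_card_ge hzle (by rw [hC, Nat.card_zmultiples, hord])
    -- `p • c` lies in the left kernel: `B (p c) w = B a₀ (p² w)` and `p² w = k • (p c)`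
    have hker : ∀ w : A, B (p • (p • a₀)) w = 0 := by
      intro w
      have hw : p • w ∈ AddSubgroup.zmultiples (p • a₀) := by
        rw [hzeq]; exact ⟨w, by rw [hf, nsmulAddMonoidHom_apply]⟩
      obtain ⟨k, hk⟩ := AddSubgroup.mem_zmultiples_iff.mp hw
      rw [apply_nsmul_comm, apply_nsmul_comm, ← hk, smul_comm p k, map_zsmul, map_nsmul, map_nsmul,
        halt, smul_zero, smul_zero, smul_zero]
    obtain ⟨y, hy⟩ := hnd _ hpc
    exact hy (hker y)

end Algebra

/-! ### §2 On `Ш(E/K)`: `#Ш[p^∞] = p⁴` and `#Sel^(p) = p²` at rank `0` kill the Cassels–Tate pairing on `Ш[p]` -/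

section General

variable {K : Type*} [Field K] [NumberField K] (W : WeierstrassCurve K) [W.IsElliptic]

/-- **Rank `0`, `p ∤ #E(K)_tors`, `#Sel^(p)(E/K) = p²`, `#Ш(E/K)[p^∞] = p⁴` ⇒ every alternating
bi-additive pairing on `Ш(E/K)` whose left kernel consists of divisible elements (the printed
properties of the Cassels–Tate pairing, bsd.S18) VANISHES on `Ш[p] × Ш[p]`.** Restrict the pairing
to the finite group `A = Ш[p^∞]` (order `p⁴`, `#A[p] = #Ш[p] = #Sel^(p) = p²` by p213922's rank-`0`
bijection): a non-zero `x ∈ A` is not divisible in `Ш` (a `p⁴`-th root of `x` would lie in `A`,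
where `p⁴` kills everything), so `B x y ≠ 0` for some `y ∈ Ш`, and replacing `y` by its
prime-to-`p` multiple `(ord y)_{p'} • y ∈ A` keeps the value non-zero; then
`apply_eq_zero_of_alternating_of_card_pow_four` applies. This is the THEOREM-side prediction
"`Ш[p^∞] ≅ (ℤ/p²)²` ⇒ the Cassels–Tate pairing on `Sel^(p) = Ш[p]` is identically zero" as a kernel
statement about any such pairing. [cite: SilvermanAEC2009, Thm X.4.14] [cite: Cassels1998, §1] -/
theorem sha_pairing_torsion_eq_zero_of_card_primaryComponent (p : ℕ) [hp : Fact p.Prime]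
    (hrank : W.mordellWeilRank = 0) (htors : ¬ p ∣ W.torsionOrder)
    (hcard : Nat.card (W.selmerGroup (p : ℤ)) = p ^ 2)
    (hprim : Nat.card (AddCommGroup.primaryComponent W.sha p) = p ^ 4)
    {Q : Type*} [AddCommGroup Q] (B : W.sha →+ W.sha →+ Q) (halt : ∀ x, B x x = 0)
    (hker : ∀ x, (∀ y, B x y = 0) → x ∈ AddSubgroup.divisibleElements W.sha) :
    ∀ x y : W.sha, p • x = 0 → p • y = 0 → B x y = 0 := by
  set A' : AddSubgroup W.sha := AddCommGroup.primaryComponent W.sha p with hA'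
  haveI : Finite A' := Nat.finite_of_card_ne_zero (by rw [hprim]; exact pow_ne_zero _ hp.out.ne_zero)
  -- the restricted pairing
  set B' : A' →+ A' →+ Q := (B.comp A'.subtype).compl₂ A'.subtype with hB'
  have hB'ap : ∀ x y : A', B' x y = B x y := fun x y => rfl
  -- `#A'[p] = p²`
  have hc : Nat.card (AddSubgroup.torsionBy W.sha p) = p ^ 2 := by
    rw [card_torsionBy_coe_eq_card_inf,
      card_sha_inf_torsionBy_eq_card_selmerGroup_of_rankZero W p hrank htors, hcard]
  have hle : AddSubgroup.torsionBy (↥W.sha) p ≤ A' := fun x hx =>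
    (AddCommGroup.mem_primaryComponent).mpr ⟨1, by rw [pow_one]; exact AddSubgroup.torsionBy.nsmul_iff.mp hx⟩
  have hAp : Nat.card (AddSubgroup.torsionBy A' p) = p ^ 2 := by
    rw [card_torsionBy_coe_eq_card_inf A' p, inf_eq_right.mpr hle, hc]
  -- everything in `A'` is killed by `p⁴`
  have hkill : ∀ z : W.sha, z ∈ A' → p ^ 4 • z = 0 := by
    intro z hz
    have h := card_nsmul_eq_zero' (G := A') (x := ⟨z, hz⟩)
    rw [hprim] at h
    simpa only [AddSubgroupClass.coe_nsmul, ZeroMemClass.coe_zero] using congrArg Subtype.val h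
  -- non-degeneracy of `B'` on `A'`
  have hnd : ∀ x : A', x ≠ 0 → ∃ y : A', B' x y ≠ 0 := by
    intro x hx
    have h1 : ∃ y : W.sha, B x y ≠ 0 := by
      by_contra h
      simp only [not_exists, not_not] at h
      obtain ⟨z, hz⟩ := (AddSubgroup.mem_divisibleElements_iff _ _).mp (hker x h) (p ^ 4)
        (pow_pos hp.out.pos 4)
      obtain ⟨n, hn⟩ := (AddCommGroup.mem_primaryComponent).mp x.2
      have hzA : z ∈ A' :=
        (AddCommGroup.mem_primaryComponent).mpr ⟨n + 4, by rw [pow_add, mul_smul, hz, hn]⟩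
      apply hx
      apply Subtype.ext
      change (x : W.sha) = 0
      rw [← hz, hkill z hzA]
    obtain ⟨y, hy⟩ := h1
    -- replace `y` by its prime-to-`p` part `m' • y ∈ A'`
    have hfin : IsOfFinAddOrder y := W.isTorsion_sha y
    have hm0 : addOrderOf y ≠ 0 := hfin.addOrderOf_pos.ne'
    set m' : ℕ := ordCompl[p] (addOrderOf y) with hm'
    have hcop : (p ^ 4).Coprime m' := (Nat.coprime_ordCompl hp.out hm0).pow_left 4
    have hy'A : m' • y ∈ A' := by
      refine (AddCommGroup.mem_primaryComponent).mpr ⟨(addOrderOf y).factorization p, ?_⟩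
      rw [← mul_smul, Nat.ordProj_mul_ordCompl_eq_self, addOrderOf_nsmul_eq_zero]
    refine ⟨⟨m' • y, hy'A⟩, ?_⟩
    intro h0
    apply hy
    rw [hB'ap] at h0
    change B x (m' • y) = 0 at h0
    rw [map_nsmul] at h0
    obtain ⟨n, hn⟩ := (AddCommGroup.mem_primaryComponent).mp x.2
    have hpn : p ^ 4 • B x y = 0 := by
      rw [← AddMonoidHom.nsmul_apply, ← map_nsmul, hkill _ x.2, map_zero, AddMonoidHom.zero_apply]
    -- coprime exponents `p⁴` and `m'` both kill `B x y`, so it vanishes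
    have h1 : addOrderOf (B x y) ∣ Nat.gcd (p ^ 4) m' :=
      Nat.dvd_gcd (addOrderOf_dvd_of_nsmul_eq_zero hpn) (addOrderOf_dvd_of_nsmul_eq_zero h0)
    rw [Nat.Coprime.gcd_eq_one hcop] at h1
    exact AddMonoid.addOrderOf_eq_one_iff.mp (Nat.dvd_one.mp h1)
  -- the algebra lemma on `A'`
  have hmain := apply_eq_zero_of_alternating_of_card_pow_four B' (fun x => halt x) hnd hprim hAp
  intro x y hx hy
  have hxA : x ∈ A' := hle (AddSubgroup.torsionBy.nsmul_iff.mpr hx)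
  have hyA : y ∈ A' := hle (AddSubgroup.torsionBy.nsmul_iff.mpr hy)
  have h := hmain ⟨x, hxA⟩ ⟨y, hyA⟩ (Subtype.ext (by simpa using hx)) (Subtype.ext (by simpa using hy))
  rwa [hB'ap] at h

end General

/-! ### §3 Over `ℚ`: `BSD(E,p)` (a THEOREM in print for the CM controls) + the EXACT analytic order `ord_p #Ш_an = 4` + `#Sel^(p) = p²` -/

section OverQ

variable (W : WeierstrassCurve ℚ) [W.IsElliptic] (p : ℕ) [hp : Fact p.Prime]

/-- **The THEOREM-side prediction of a ZERO Gram matrix, as a kernel statement.** For `E/ℚ` of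
analytic rank `0` (GZK `hGZK`), `p ∤ #E(ℚ)_tors`, `#Sel^(p)(E/ℚ) = p²` (two descent engines), Miller's
`BSD(E,p)` (`hbsd` — for the CM controls a THEOREM: Rubin 1991 Thm. 12.3, tree route
`Rubin1991.pPartRankZero_of_cm` ∘ `bsdp_of_pPartRankZero`) and the EXACT analytic order
`#Ш_an = q` with `ord_p q = 4` (`hq`, `hv` — gen 16: Birch's twisted modular-symbol formula at the
base level, exact), EVERY alternating bi-additive pairing on `Ш(E/ℚ)` whose left kernel consists of
divisible elements vanishes on `Ш[p] × Ш[p]`: `#Ш[p^∞] = p⁴` from `BSD(E,p)` and `hq`/`hv`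
(`exists_card_addPrimaryComponent_eq_pow`), then
`sha_pairing_torsion_eq_zero_of_card_primaryComponent`. Per curve; books nothing.
[cite: Miller2011LMS, Def. 1.1] [cite: SilvermanAEC2009, Thm X.4.14] -/
theorem sha_pairing_torsion_eq_zero_of_bsdp
    (hGZK : rank_eq_analyticRank_of_analyticRank_le_one) (hr : W.analyticRank = 0)
    (htors : ¬ p ∣ W.torsionOrder) (hcard : Nat.card (W.selmerGroup (p : ℤ)) = p ^ 2)
    (hbsd : BSDp W p) {q : ℚ} (hq : shaAn W = (q : ℂ)) (hv : padicValRat p q = 4)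
    {Q : Type*} [AddCommGroup Q] (B : W.sha →+ W.sha →+ Q) (halt : ∀ x, B x x = 0)
    (hker : ∀ x, (∀ y, B x y = 0) → x ∈ AddSubgroup.divisibleElements W.sha) :
    ∀ x y : W.sha, p • x = 0 → p • y = 0 → B x y = 0 := by
  obtain ⟨hrk, hfin, q', hq', hv'⟩ := hbsd
  haveI := hfin
  have hqq : q' = q := by
    have h := hq'.symm.trans hq
    exact_mod_cast h
  obtain ⟨n, hn⟩ := exists_card_addPrimaryComponent_eq_pow (A := W.sha) p
  rw [hqq, hv, hn, padicValNat.prime_pow] at hv'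
  have hn4 : n = 4 := by exact_mod_cast hv'.symm
  rw [hn4] at hn
  have hr1 : W.analyticRank ≤ 1 := by rw [hr]; norm_num
  have hrank : W.mordellWeilRank = 0 := by rw [(hGZK W hr1).1, hr]
  exact sha_pairing_torsion_eq_zero_of_card_primaryComponent W p hrank htors hcard hn B halt hker

/-- **Record shape for a literal integer model (class-free; `E[3]` irreducible kernel-decided).** For a
globally minimal `W` with integral model `[a₁,…,a₆]`: a good prime `ℓ ≠ 3` with `#Ẽ(𝔽_ℓ) = n` and
`X² − (ℓ+1−n)X + ℓ` root-free mod `3` gives `E[3]` irreducible (Mazur), hence `3 ∤ #E(ℚ)_tors`; with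
`r_an = 0`, `#Sel^(3)(E/ℚ) = 9`, `BSD(E,3)` and the EXACT `ord₃ #Ш_an = 4`,
`sha_pairing_torsion_eq_zero_of_bsdp` gives the vanishing of every Cassels–Tate-shaped pairing on
`Ш[3] × Ш[3]`. Per pair; books nothing. [cite: Miller2011LMS, Def. 1.1]
[cite: Mazur1978, §6 Prop. 6.3 (1) (p. 153)] [cite: SilvermanAEC2009, Thm X.4.14] -/
theorem sha_pairing_three_torsion_eq_zero_of_ainvs_of_bsdp
    (hGZK : rank_eq_analyticRank_of_analyticRank_le_one)
    (a1 a2 a3 a4 a6 : ℤ) {W : WeierstrassCurve ℚ} [W.IsElliptic] [W.IsGloballyMinimal]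
    (hW : integralModelInt W = ⟨a1, a2, a3, a4, a6⟩) (ℓ n : ℕ) [Fact ℓ.Prime]
    (hℓ3 : ℓ ≠ 3) (hℓΔ : ¬ (ℓ : ℤ) ∣ discOf [a1, a2, a3, a4, a6])
    (hcnt : Nat.card (((⟨a1, a2, a3, a4, a6⟩ : WeierstrassCurve ℤ).map
      (Int.castRingHom (ZMod ℓ))).toAffine.Point) = n)
    (hnoroot : ∀ t : ℕ, t < 3 → ¬ (3 : ℤ) ∣ (t : ℤ) ^ 2 - ((ℓ : ℤ) + 1 - n) * t + ℓ)
    (hr : W.analyticRank = 0) (hcard : Nat.card (W.selmerGroup (3 : ℤ)) = 9)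
    (hbsd : BSDp W 3) {q : ℚ} (hq : shaAn W = (q : ℂ)) (hv : padicValRat 3 q = 4)
    {Q : Type*} [AddCommGroup Q] (B : W.sha →+ W.sha →+ Q) (halt : ∀ x, B x x = 0)
    (hker : ∀ x, (∀ y, B x y = 0) → x ∈ AddSubgroup.divisibleElements W.sha) :
    ∀ x y : W.sha, 3 • x = 0 → 3 • y = 0 → B x y = 0 := by
  haveI : Fact (Nat.Prime 3) := ⟨by norm_num⟩
  have hΔ : (⟨a1, a2, a3, a4, a6⟩ : WeierstrassCurve ℤ).Δ = discOf [a1, a2, a3, a4, a6] :=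
    intCurve_Δ a1 a2 a3 a4 a6
  have hirr : Irr W 3 := by
    refine hasIrreducibleModPGaloisRep_of_intModel_of_noroot hW 3 ℓ hℓ3 (by rw [hΔ]; exact hℓΔ) hcnt
      (forall_zmod_of_forall_lt fun t ht h0 ↦ hnoroot t ht ?_)
    change ((3 : ℕ) : ℤ) ∣ _
    rw [← ZMod.intCast_zmod_eq_zero_iff_dvd]
    push_cast at h0 ⊢
    linear_combination h0
  exact sha_pairing_torsion_eq_zero_of_bsdp W 3 hGZK hr
    (Supersingular.not_dvd_torsionOrder_of_irr W 3 hirr)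
    (by rw [show (3 : ℕ) ^ 2 = 9 by norm_num]; exact hcard) hbsd hq hv B halt hker

end OverQ

end Summit.BirchSwinnertonDyer.Rank1Residual.X10

end
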